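import Literature.AlgebraicGeometry.HodgeTheory.ComplementDeathConstantRationalOpen
import Literature.AlgebraicGeometry.HodgeTheory.ComplementLocalTrivialityRationalOpenPieces
import HarnessLib

/-!
# Death of a global class off a `k`-closed subset is constant over a `k`-rational open — total space not irreducible

Topic `Literature/AlgebraicGeometry/HodgeTheory` (family `hodge`). Theorems only (no definition, no
named fact; D-0026). The statement of `ComplementDeathConstantRationalOpen.lean`
(`map_fiberι_mem_ker_restrictCompl_iff_of_baseChangeHom`) with the hypothesis `IsIntegral X₀.left`
REMOVED and `SmoothOfRelativeDimension n g₀.left` weakened to `Smooth g₀.left`: for `σ : k →+* ℂ`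
(`k` of characteristic zero), `g₀ : X₀ ⟶ B₀` proper and smooth between `k`-schemes (`B₀` integral,
separated, quasi-compact, locally of finite type, smooth of relative dimension `d` over `k`, with
irreducible complexification `B`), `C₀ ⊆ X₀` closed and `A ∈ Hᵏ(X(ℂ); ℂ)`, there is an open
`O₀ ∋ η_{B₀}` of `B₀` such that for any two complex points `y, y'` of `B` over `O₀`:
`A|_{X_y}` dies off `X_y ∩ π_X⁻¹ C₀` iff `A|_{X_{y'}}` dies off `X_{y'} ∩ π_X⁻¹ C₀`. The proof is
that of the integral case verbatim, the local triviality of the complement family over a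
`k`-rational open being now supplied by
`exists_opens_isLocallyTrivialFibration_compl_of_baseChangeHom'`
(`ComplementLocalTrivialityRationalOpenPieces.lean`: clopen decomposition of the regular `X₀` into
irreducible components and gluing). This is the form used by the spreading argument for the
variational Hodge conjecture, where the total space `𝒳₀ ×_{S₀} T₀` of the spread family is smooth
over `k` but in general neither irreducible nor of a relative dimension known over `k`
(Voisin, *Hodge Theory II*, §3.3.1; Charles–Schnell 2014, proof of Prop. 11.3.11).

## References

* [VoisinHodgeI2002] C. Voisin, Hodge Theory and Complex Algebraic Geometry I (2002), §9.1.1,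
  Thm. 9.3.
* [VoisinHodgeII2003] C. Voisin, Hodge Theory and Complex Algebraic Geometry II (2003), §3.3.1.
* [CharlesSchnell2014Notes] F. Charles, C. Schnell, Notes on absolute Hodge classes (2014),
  Prop. 11.3.11 (proof), Lemma 11.3.14.
* [HatcherAT2002] A. Hatcher, Algebraic Topology (2002), §3.1 Thm. 3.2.
-/

noncomputable section

open CategoryTheory AlgebraicGeometry Limits Set TopologicalSpace Filter
open MonoidalCategory CartesianMonoidalCategory
open _root_.Topology
open Literature.AlgebraicGeometry.Motives Literature.AlgebraicTopology.Homotopy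
open Literature.AlgebraicTopology.SingularHomology

namespace Literature.AlgebraicGeometry.HodgeTheory

section Schemes

variable {k : Type} [Field k] [CharZero k] (σ : k →+* ℂ) {X₀ B₀ : SchemeOver k} (g₀ : X₀ ⟶ B₀)
  {d : ℕ}

omit [CharZero k] in
/-- `Spec ℂ → Spec k` is surjective (one point onto one point). [folklore] -/
private theorem surjective_specMap' : Surjective (Spec.map (CommRingCat.ofHom σ)) := by
  haveI : Subsingleton ↥(Spec (CommRingCat.of k)) :=
    inferInstanceAs (Subsingleton (PrimeSpectrum k))
  exact ⟨fun x ↦ ⟨(default : ↥(Spec (CommRingCat.of ℂ))), Subsingleton.elim _ _⟩⟩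

/-- **Death of a global class off a `k`-closed subset is constant over a `k`-rational open**
(total space not assumed irreducible). Let `σ : k →+* ℂ` (`k` of characteristic zero),
`g₀ : X₀ ⟶ B₀` proper and smooth, `B₀` integral, separated, quasi-compact, locally of finite type
and smooth of relative dimension `d` over `k`, with IRREDUCIBLE complexification `B = B₀ ⊗_σ ℂ`,
`C₀ ⊆ X₀` closed and `A ∈ Hᵏ(X(ℂ); ℂ)` a class on the complexified total space `X = X₀ ⊗_σ ℂ`.
Then there is an open `O₀ ⊆ B₀` containing the generic point of `B₀` such that for any two
complex points `y, y'` of `B` over `O₀`, `A|_{X_y}` dies off the slice `X_y ∩ π_X⁻¹C₀` iff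
`A|_{X_{y'}}` dies off `X_{y'} ∩ π_X⁻¹C₀`. Proof: over `O₀` the complement family is a locally
trivial fibration (`exists_opens_isLocallyTrivialFibration_compl_of_baseChangeHom'`); death on its
fibres is open (`isOpen_setOf_map_subtypeVal_fiber_eq_zero`) and closed on the connected set of
complex points over `O₀`, and the fibres of the scheme-theoretic fibre off the slice are the
topological ones (`map_fiberι_mem_ker_restrictCompl_iff`).
[cite: VoisinHodgeI2002, §9.1.1, Thm. 9.3] [cite: CharlesSchnell2014Notes, Prop. 11.3.11 (proof) and Lemma 11.3.14] -/
theorem map_fiberι_mem_ker_restrictCompl_iff_of_baseChangeHom'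
    [IsProper g₀.left] [Smooth g₀.left] [IsIntegral B₀.left] [LocallyOfFiniteType B₀.hom]
    [SmoothOfRelativeDimension d B₀.hom] [IsSeparated B₀.hom] [CompactSpace B₀.left]
    [IrreducibleSpace ((baseChangeHom σ).obj B₀).left] (C₀ : Set X₀.left) (hC₀ : IsClosed C₀)
    (kk : ℕ) (A : complexBetti ((baseChangeHom σ).obj X₀) kk) :
    ∃ O₀ : B₀.left.Opens, genericPoint B₀.left ∈ O₀ ∧
      ∀ y y' : ComplexPoints ((baseChangeHom σ).obj B₀),
        baseChangeHomFst σ B₀ y.pt ∈ O₀ → baseChangeHomFst σ B₀ y'.pt ∈ O₀ →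
        (complexBetti.map (fiberι ((baseChangeHom σ).map g₀) y) kk A ∈
            LinearMap.ker (complexBetti.restrictCompl (fiberOver ((baseChangeHom σ).map g₀) y)
              ((fiberι ((baseChangeHom σ).map g₀) y).left ⁻¹'
                ((baseChangeHomFst σ X₀) ⁻¹' C₀)) kk).hom ↔
          complexBetti.map (fiberι ((baseChangeHom σ).map g₀) y') kk A ∈
            LinearMap.ker (complexBetti.restrictCompl (fiberOver ((baseChangeHom σ).map g₀) y')
              ((fiberι ((baseChangeHom σ).map g₀) y').left ⁻¹'
                ((baseChangeHomFst σ X₀) ⁻¹' C₀)) kk).hom) := by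
  classical
  obtain ⟨O₀, hη, hF⟩ :=
    exists_opens_isLocallyTrivialFibration_compl_of_baseChangeHom' σ g₀ (d := d) C₀ hC₀
  refine ⟨O₀, hη, fun y y' hy hy' => ?_⟩
  -- notation
  let X : SchemeOver ℂ := (baseChangeHom σ).obj X₀
  let B : SchemeOver ℂ := (baseChangeHom σ).obj B₀
  let g : X ⟶ B := (baseChangeHom σ).map g₀
  let prX : X.left ⟶ X₀.left := baseChangeHomFst σ X₀
  let prB : B.left ⟶ B₀.left := baseChangeHomFst σ B₀
  -- instances on the complexified data
  have Hg : IsPullback prX g.left g₀.left prB := by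
    letI := σ.toAlgebra
    exact (isPullback_baseChange_map_left ℂ g₀).flip
  haveI : IsProper g.left := MorphismProperty.of_isPullback (P := @IsProper) Hg inferInstance
  haveI : LocallyOfFiniteType X₀.hom := by rw [← Over.w g₀]; infer_instance
  haveI : IsSeparated X₀.hom := by rw [← Over.w g₀]; infer_instance
  haveI : IsSeparated X.hom := by
    change IsSeparated (pullback.snd X₀.hom (Spec.map (CommRingCat.ofHom σ)))
    infer_instance
  haveI : LocallyOfFiniteType B.hom := by
    change LocallyOfFiniteType (pullback.snd B₀.hom (Spec.map (CommRingCat.ofHom σ)))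
    infer_instance
  haveI : SmoothOfRelativeDimension d B.hom := smoothOfRelativeDimension_baseChangeHom_hom σ d B₀
  haveI : Smooth B.hom := SmoothOfRelativeDimension.smooth d B.hom
  haveI : Surjective prB := by
    haveI := surjective_specMap' σ
    exact MorphismProperty.pullback_fst (P := @Surjective) _ _ inferInstance
  -- the death condition on the topological fibres off the slice
  let C : Set (ComplexPoints B × ComplexPoints X) := {q | prX q.2.pt ∈ C₀}
  have hT : ∀ z : ComplexPoints B,
      complexBetti.map (fiberι g z) kk A ∈
          LinearMap.ker (complexBetti.restrictCompl (fiberOver g z)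
            ((fiberι g z).left ⁻¹' (prX ⁻¹' C₀)) kk).hom ↔
        singularCohomology.map ℂ ℂ (⟨Subtype.val, continuous_subtype_val⟩ :
          C({e : ComplexPoints X // AlgPoints.map g e = z ∧ (z, e) ∉ C}, ComplexPoints X)) kk A = 0 :=
    fun z => map_fiberι_mem_ker_restrictCompl_iff g (id : ComplexPoints B → ComplexPoints B) C
      (fun z => (fiberι g z).left ⁻¹' (prX ⁻¹' C₀)) (fun z P => Iff.rfl) kk A z
  rw [hT y, hT y']
  -- the complement fibration over `O₀` and its base
  let Osub : Set (ComplexPoints B) := {β | prB β.pt ∈ O₀}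
  let EF := {x : ComplexPoints X // prX x.pt ∉ C₀ ∧ prB (g.left x.pt) ∈ O₀}
  let Fm : EF → ↥Osub := fun x => ⟨AlgPoints.map g x.1, x.2.2⟩
  have hFm : IsLocallyTrivialFibration Fm := hF
  -- the base is locally path connected and connected
  have hOopen : IsOpen Osub := AlgPoints.isOpen_setOf_pt_mem (X := B) (L := ℂ) (prB ⁻¹ᵁ O₀)
  haveI : LocallyPathConnectedSpace (ComplexPoints B) := locallyPathConnectedSpace_complexPoints_of_smooth B
  haveI : LocallyPathConnectedSpace ↥Osub := hOopen.locallyPathConnectedSpace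
  have hOne : ((Set.univ : Set B.left) ∩ ((prB ⁻¹ᵁ O₀ : B.left.Opens) : Set B.left)).Nonempty := by
    obtain ⟨b, hb⟩ := (inferInstance : Surjective prB).surj (genericPoint B₀.left)
    refine ⟨b, Set.mem_univ _, ?_⟩
    change prB b ∈ O₀
    rw [hb]; exact hη
  have hconn : IsConnected Osub := by
    have h := ComplexPoints.isConnected_setOf_pt_mem_inter_of_isIrreducible B isClosed_univ
      (IrreducibleSpace.isIrreducible_univ _) (prB ⁻¹ᵁ O₀) hOne
    have heq : {P : ComplexPoints B | P.pt ∈ (Set.univ : Set B.left) ∧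
        P.pt ∈ ((prB ⁻¹ᵁ O₀ : B.left.Opens) : Set B.left)} = Osub := by
      ext P
      simp only [Set.mem_univ, true_and, Set.mem_setOf_eq]
      rfl
    rwa [heq] at h
  haveI : PreconnectedSpace ↥Osub := Subtype.preconnectedSpace hconn.isPreconnected
  -- the class pulled back to the total space of the complement fibration
  let ιE : C(EF, ComplexPoints X) := ⟨Subtype.val, continuous_subtype_val⟩
  let A' : singularCohomology ℂ ℂ EF kk := singularCohomology.map ℂ ℂ ιE kk A
  have hconst := map_subtypeVal_fiber_eq_zero_iff_of_preconnectedSpace ℂ hFm A' ⟨y, hy⟩ ⟨y', hy'⟩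
  -- death on a fibre of `Fm` versus death on the fibre off the slice, for `A`
  have hfib : ∀ (z : ComplexPoints B) (hz : prB z.pt ∈ O₀),
      singularCohomology.map ℂ ℂ (⟨Subtype.val, continuous_subtype_val⟩ :
          C({e : EF // Fm e = ⟨z, hz⟩}, EF)) kk A' = 0 ↔
        singularCohomology.map ℂ ℂ (⟨Subtype.val, continuous_subtype_val⟩ :
          C({e : ComplexPoints X // AlgPoints.map g e = z ∧ (z, e) ∉ C}, ComplexPoints X)) kk A = 0 := by
    intro z hz
    have hcomp : singularCohomology.map ℂ ℂ (⟨Subtype.val, continuous_subtype_val⟩ :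
        C({e : EF // Fm e = ⟨z, hz⟩}, EF)) kk A' =
        singularCohomology.map ℂ ℂ (ιE.comp (⟨Subtype.val, continuous_subtype_val⟩ :
          C({e : EF // Fm e = ⟨z, hz⟩}, EF))) kk A := by
      change singularCohomology.map ℂ ℂ _ kk (singularCohomology.map ℂ ℂ ιE kk A) = _
      rw [← ModuleCat.comp_apply, ← singularCohomology.map_comp]
    rw [hcomp]
    refine (map_eq_zero_iff_of_homeomorph ℂ
      (⟨Subtype.val, continuous_subtype_val⟩ :
        C({e : ComplexPoints X // AlgPoints.map g e = z ∧ (z, e) ∉ C}, ComplexPoints X))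
      (ιE.comp (⟨Subtype.val, continuous_subtype_val⟩ : C({e : EF // Fm e = ⟨z, hz⟩}, EF)))
      { toFun := fun u => ⟨⟨u.1, u.2.2, by
            have h1 : g.left u.1.pt = z.pt := by
              rw [← AlgPoints.pt_map, u.2.1]
            change prB (g.left u.1.pt) ∈ O₀
            rw [h1]; exact hz⟩, Subtype.ext u.2.1⟩
        invFun := fun x => ⟨x.1.1, congrArg Subtype.val x.2, x.1.2.1⟩
        left_inv := fun u => rfl
        right_inv := fun x => rfl
        continuous_toFun := ((continuous_subtype_val.subtype_mk _).subtype_mk _)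
        continuous_invFun := (continuous_subtype_val.comp continuous_subtype_val).subtype_mk _ }
      (fun u => rfl) A).symm
  rw [← hfib y hy, ← hfib y' hy']
  exact hconst

end Schemes

end Literature.AlgebraicGeometry.HodgeTheory

end
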